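import Summits.BirchSwinnertonDyer.BirchSwinnertonDyer.Theorems.SchneiderFreeAdditiveX3UpperWingSplit
import HarnessLib
import HarnessLib.Audit.Tags

/-!
# Schneider-free additive X3 door, SECOND WING — the rung-leaf candidate `Upper.AdditiveX3RankOneUpper`
# (the UPPER half of BSD_p on B6 ∩ X3 ∩ sst-twist in analytic rank one), its two-leaves reading, and its
# by-name closer from the wing's two class-wide inputs (Theses-free)

Cell `bsd-schneider-ideate`, seat `bsd-schneider-door-c5` (prover, generation 9). Planner P2 gen 13's sibling-route
birth package `memos/route-P2-upper/` (README, 03:30Z) waits, among other things, for «a prover landing the 15-line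
leaf `def` in Theorems (door-c5 deferred it explicitly pending U25)» — the package's `Sketch.lean` carries a LOCAL
copy `AdditiveX3RankOneUpperLocal` and its `glue.lean` names THIS decl. Declared here VERBATIM from the planner's
kernel-checked Sketch `memos/ROUTE-P2-upper-v2-g13-Sketch.lean` §3 (same shape as the door's registered rung leaf
`SchneiderFree.AdditiveX3RankOneLower`, `Theorems/SchneiderFreeSockets.lean`):

* `Upper.AdditiveX3RankOneUpper` — ∀ globally minimal `W`, odd `p`: `r_an = 1 → ClassX3 → SubSemistableTwist →
  Typed.MissingUpperBoundAt W p`. A predicate (`@[conjecture]`, nothing asserted). Its REGISTRATION as a class-rung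
  `closes_target` (D-0061) is the director's / operator's act (U25), NOT done by landing this file.
* `Upper.missingPPartAt_of_lower_of_upper_leaves` — the two wings are the rank-one residue of X3♯ on the cells.
* `Upper.additiveX3RankOneUpper_of_coChain_of_twistUnitField` — the leaf BY NAME from seven printed facts + the
  wing's two class-wide inputs in SPLIT form (`hG` = the body of `GoodMemberCoChainX3`, `hT` = the body of
  `TwistUnitX3Split`; the Props themselves are route items, not declared) — one line over
  `Upper.missingUpperBoundAt_sstTwist_of_coChain_of_twistUnitField` (p489359); and
  `Upper.additiveX3RankOneUpper_of_coIMCs_of_control_of_twistUnitField` — the same from the THREE socket-shaped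
  inputs (`hCtl`, `hCoG`, `hCoM`) + `hTU`, i.e. the birth package's `closes_local` with the real leaf name.

HONEST FRAMING: a definition and glue; CONDITIONAL closers; registers nothing; closes no item; BSD is not advanced.
References: [Miller2011LMS] Def. 1.1; [JetchevSkinnerWan2017] §7.4.1; [GrossZagier1986] I.(6.3), (7.3).
-/

noncomputable section

open scoped Classical

open WeierstrassCurve NumberField IsDedekindDomain Field Literature.NumberTheory.EllipticCurves
  Literature.NumberTheory.EllipticCurves.ModularForms Literature.NumberTheory.EllipticCurves.GreenbergSelmer
  Literature.NumberTheory.EllipticCurves.Rank1Residual Literature.NumberTheory.EllipticCurves.Rank1Residual.Typed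
  Literature.NumberTheory.GaloisRepresentations Literature.NumberTheory.EllipticCurves.KellerYin2024
  Summit.BirchSwinnertonDyer.Rank1Residual Summit.BirchSwinnertonDyer.Rank1Residual.Additive
  Summit.BirchSwinnertonDyer.Rank1Residual.X11b
  Summit.BirchSwinnertonDyer.BirchSwinnertonDyer.Theorems.SchneiderFree

set_option linter.dupNamespace false
set_option autoImplicit false

namespace Summit.BirchSwinnertonDyer.BirchSwinnertonDyer.Theorems.SchneiderFree.Upper

/-! ### §1 The rung-leaf candidate of the second wing -/

/-- **RUNG-LEAF candidate `AdditiveX3RankOneUpper` (the second wing; P2 gen 13 Sketch §3 VERBATIM):** on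
B6 ∩ X3 ∩ sst-twist in analytic rank one, the UPPER half of BSD_p — for every globally minimal `E/ℚ` with
`r_an(E) = 1`, every odd additive `p` with `E[p]` reducible (`ClassX3`) and `E^{(p*)}` semistable at `p`
(`SubSemistableTwist` = (M) ∪ (G-ord, `e = 2`)), `#Ш(E)_an` is a rational `q` with `ord_p #Ш(E) ≤ ord_p q`
(`MissingUpperBoundAt`). With the door's leaf `AdditiveX3RankOneLower` it is the rank-one residue of X3♯ on these
cells (`MissingPPartAt`). CLOSED (no section variables); OPEN; nothing asserted; NOT registered by this file.
[cite: Miller2011LMS, Def. 1.1] -/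
@[conjecture]
def AdditiveX3RankOneUpper : Prop :=
  ∀ (W : WeierstrassCurve ℚ) [W.IsElliptic] [W.IsGloballyMinimal] (p : ℕ) [Fact p.Prime],
    W.analyticRank = 1 → p ≠ 2 → ClassX3 W p → Additive.SubSemistableTwist W p →
      MissingUpperBoundAt W p

/-- Closedness check: the leaf is a `Prop` with no hidden binders. [folklore] -/
example : (id AdditiveX3RankOneUpper : Prop) = AdditiveX3RankOneUpper := rfl

/-- The two wings are the rank-one residue of X3♯ (`MissingPPartAt`, both halves of BSD_p) on the
semistable-twist cells (P2 gen 13 Sketch §3 VERBATIM). [cite: Miller2011LMS, Def. 1.1] -/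
theorem missingPPartAt_of_lower_of_upper_leaves (hL : SchneiderFree.AdditiveX3RankOneLower)
    (hU : AdditiveX3RankOneUpper) :
    ∀ (W : WeierstrassCurve ℚ) [W.IsElliptic] [W.IsGloballyMinimal] (p : ℕ) [Fact p.Prime],
      W.analyticRank = 1 → p ≠ 2 → ClassX3 W p → Additive.SubSemistableTwist W p → MissingPPartAt W p :=
  fun W _ _ p _ hr hp2 hX hS ↦ missingPPartAt_of_lower_of_upper W p (hL W p hr hp2 hX hS) (hU W p hr hp2 hX hS)

/-! ### §2 The leaf BY NAME from the wing's class-wide inputs -/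

/-- **`AdditiveX3RankOneUpper` from TWO class-wide inputs in split form** — seven printed facts (GZ I.(6.3),
Kolyvagin, GZK, modularity, GZ I.(7.3), Cassels, Heegner points over `K`) + `hG` (some member runs the co-chain
over every imaginary quadratic Heegner field with `p ∤ d_K` — the body of the memo's derived node
`GoodMemberCoChainX3`) + `hT` (the split twist-unit datum on the cell — the body of `TwistUnitX3Split`) ⟹ the leaf.
One line over `Upper.missingUpperBoundAt_sstTwist_of_coChain_of_twistUnitField`. CONDITIONAL on `hG`, `hT`;
closes no item; BSD not advanced. [cite: Miller2011LMS, Def. 1.1] [cite: GrossZagier1986, Thm. I.(6.3) and (7.3)] -/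
theorem additiveX3RankOneUpper_of_coChain_of_twistUnitField
    (hGZ : ∀ (N : ℕ) [NeZero N] (W : WeierstrassCurve ℚ) (K : Type) [Field K] [NumberField K],
      gross_zagier N W K)
    (hKo : ∀ (N : ℕ) [NeZero N] (W : WeierstrassCurve ℚ) (K : Type) [Field K] [NumberField K],
      kolyvagin N W K)
    (hGZK : rank_eq_analyticRank_of_analyticRank_le_one) (hmod : hasEntireLFunction_rat)
    (hGZ73 : GrossZagier1986_thm_I_7_3) (hCassels : bsdRHS_eq_of_isIsogenous)
    (hHP : ∀ (W : WeierstrassCurve ℚ) (K : Type) [Field K] [NumberField K], exists_isHeegnerPoint W K)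
    (hG : ∀ (W : WeierstrassCurve ℚ) [W.IsElliptic] [W.IsGloballyMinimal] (p : ℕ) [Fact p.Prime],
      W.analyticRank = 1 → p ≠ 2 → ClassX3 W p → Additive.SubSemistableTwist W p →
      ∀ (K : Type) [Field K] [NumberField K], IsImaginaryQuadratic K →
        SatisfiesHeegnerHypothesis (W.conductorNorm ℤ) K → ¬ (p : ℤ) ∣ NumberField.discr K →
        ∃ (W₁ : WeierstrassCurve ℚ) (_ : W₁.IsElliptic) (_ : W₁.IsGloballyMinimal),
          IsIsogenous W W₁ ∧ W₁.conductorNorm ℤ = W.conductorNorm ℤ ∧ Additive.N10.Locus W₁ p ∧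
          (∀ Q : (W₁.baseChange K).toAffine.Point, p • Q = 0 → Q = 0) ∧ AdditiveCoStepLInputManinAt W₁ p)
    (hT : ∀ (W : WeierstrassCurve ℚ) [W.IsElliptic] [W.IsGloballyMinimal] (p : ℕ) [Fact p.Prime],
      W.analyticRank = 1 → p ≠ 2 → ClassX3 W p → Additive.SubSemistableTwist W p → TwistUnitFieldAt W p) :
    AdditiveX3RankOneUpper :=
  missingUpperBoundAt_sstTwist_of_coChain_of_twistUnitField hGZ hKo hGZK hmod hGZ73 hCassels hHP hG hT

/-- **`AdditiveX3RankOneUpper` from the wing's THREE socket-shaped inputs + the split twist-unit datum** —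
eight printed facts (the seven above + a parametrisation datum), the control corner's conclusion `hCtl` (items
19295/19548), the co-sockets `hCoG` / `hCoM` at KY-normalised curves of each cell, and `hTU` ⟹ the leaf: the birth
package's `closes_local` with the real leaf name (one line over
`Upper.missingUpperBoundAt_sstTwist_of_coIMCs_of_control_of_twistUnitField`). CONDITIONAL on every displayed
hypothesis; closes no item; BSD not advanced. [cite: JetchevSkinnerWan2017, §7.4.1 (arXiv:1512.06894 p. 30)]
[cite: Miller2011LMS, Def. 1.1] [cite: KellerYin2024b, Thm. 3.5.1 (arXiv:2410.23241 p. 20) (shape of hCoG; preprint)] -/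
theorem additiveX3RankOneUpper_of_coIMCs_of_control_of_twistUnitField
    (hGZ : ∀ (N : ℕ) [NeZero N] (W : WeierstrassCurve ℚ) (K : Type) [Field K] [NumberField K],
      gross_zagier N W K)
    (hKo : ∀ (N : ℕ) [NeZero N] (W : WeierstrassCurve ℚ) (K : Type) [Field K] [NumberField K],
      kolyvagin N W K)
    (hGZK : rank_eq_analyticRank_of_analyticRank_le_one) (hmod : hasEntireLFunction_rat)
    (hPar : nonempty_modularParametrizationData) (hGZ73 : GrossZagier1986_thm_I_7_3)
    (hCassels : bsdRHS_eq_of_isIsogenous)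
    (hHP : ∀ (W : WeierstrassCurve ℚ) (K : Type) [Field K] [NumberField K], exists_isHeegnerPoint W K)
    (hCtl : ∀ (W : WeierstrassCurve ℚ) [W.IsElliptic] [W.IsGloballyMinimal] (p : ℕ) [Fact p.Prime],
      W.analyticRank = 1 → p ≠ 2 → ClassX3 W p → Additive.SubSemistableTwist W p →
      AdditiveControlInputManinAt W p)
    (hCoG : ∀ (W : WeierstrassCurve ℚ) [W.IsElliptic] [W.IsGloballyMinimal] (p : ℕ) [Fact p.Prime],
      p ≠ 2 → ClassX3 W p → Additive.SubGordTwo W p →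
      (∃ Φ : AddSubgroup (geomTorsion W (p : ℤ)), IsRationalLine W p Φ ∧ ¬ LineDecompositionTrivialAt W p Φ) →
      AdditiveIMCUpperBDPInputManinAt W p)
    (hCoM : ∀ (W : WeierstrassCurve ℚ) [W.IsElliptic] [W.IsGloballyMinimal] (p : ℕ) [Fact p.Prime],
      p ≠ 2 → ClassX3 W p → Additive.SubM W p →
      (∃ Φ : AddSubgroup (geomTorsion W (p : ℤ)), IsRationalLine W p Φ ∧ ¬ LineDecompositionTrivialAt W p Φ) →
      AdditiveIMCUpperBDPInputManinAt W p)
    (hTU : ∀ (W : WeierstrassCurve ℚ) [W.IsElliptic] [W.IsGloballyMinimal] (p : ℕ) [Fact p.Prime],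
      W.analyticRank = 1 → p ≠ 2 → ClassX3 W p → Additive.SubSemistableTwist W p → TwistUnitFieldAt W p) :
    AdditiveX3RankOneUpper :=
  missingUpperBoundAt_sstTwist_of_coIMCs_of_control_of_twistUnitField hGZ hKo hGZK hmod hPar hGZ73 hCassels hHP
    hCtl hCoG hCoM hTU

end Summit.BirchSwinnertonDyer.BirchSwinnertonDyer.Theorems.SchneiderFree.Upper

end
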